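import Mathlib
import Summits.Ventures.PercRepro2.Tail2DBlockCalc
import Summits.Ventures.PercRepro2.Tail2DHarrisSP
import Summits.Ventures.PercRepro2.Tail2DFlowOneBlocks
import Summits.Ventures.PercRepro2.Tail2DFlowOneThreeCounts

/-!
# Three flow-one networks in parallel: the tile-to-tile certificates
(seat mine-b, cell pub-perc-repro2; conjectures/MINE-B.md §43)

Five positions of (SD) on `Z = (s ∥ t) ∥ r` (three flow-one factors with red crossings) have certificates in which
every tile of the source goes to tiles of the target with weights that are ratios of tile sizes: `(3,0)` — `RRR`
flips one of its three reds (weights `1/3`); `(2,1)` — each of `RRB, RBR, BRR` flips one red, a perfect matching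
onto `RBB, BRB, BBR`; `(1,2)` — each of `RBB, BRB, BBR` flips its red into `BBB`; `(0,2)` — the tiles
`BBB, BB row, B row B, row B B` of `E(0,2)` by the first two blues are promoted to `BBB` (`row ≼ B`); `(3,−1)` —
`RRR` is spread over the tiles `RRR, RR col, R col R, col R R` of `E(2,0)` by relaxing a red (`R ≼ col`).
-/

namespace Summit.Ventures.PercRepro2.Tail2D

open V2Closure Finset

section Certificates

variable (s t r : V2Closure.SP)

/-- **the certificate at `(3,0)`**: `RRR ≼ RRB ⊔ RBR ⊔ BRR` — flip one of the three reds -/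
theorem cert3_30 (hs : FlowOne s) (ht : FlowOne t) (hr : FlowOne r) (ha : 0 < (rSet s).card)
    (ha' : 0 < (rSet t).card) (ha'' : 0 < (rSet r).card) :
    BlockDom (V2Closure.SP.par (V2Closure.SP.par s t) r)
      (tailSet (V2Closure.SP.par (V2Closure.SP.par s t) r) 3 0)
      (tailSet (V2Closure.SP.par (V2Closure.SP.par s t) r) 2 1) := by
  obtain ⟨hB, -, -, -, hRne, hBne, -, -⟩ := counts s hs ha
  obtain ⟨hB', -, -, -, hR'ne, hB'ne, -, -⟩ := counts t ht ha'
  obtain ⟨hB'', -, -, -, hR''ne, hB''ne, -, -⟩ := counts r hr ha''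
  have ha0 : ((rSet s).card : ℚ) ≠ 0 := by exact_mod_cast ne_of_gt ha
  have ha'0 : ((rSet t).card : ℚ) ≠ 0 := by exact_mod_cast ne_of_gt ha'
  have ha''0 : ((rSet r).card : ℚ) ≠ 0 := by exact_mod_cast ne_of_gt ha''
  have hE := tailCount_par3_30 s t r hs ht hr
  have hE' := tailCount_par3_21 s t r hs ht hr
  refine blockDom_par_of_certificate (V2Closure.SP.par s t) r
      ![(rSet s ×ˢ rSet t : Finset (V2Closure.SP.par s t).Conf), (rSet s ×ˢ rSet t : Finset (V2Closure.SP.par s t).Conf),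
        (rSet s ×ˢ rSet t : Finset (V2Closure.SP.par s t).Conf)]
      ![(rSet s ×ˢ rSet t : Finset (V2Closure.SP.par s t).Conf), (rSet s ×ˢ bSet t : Finset (V2Closure.SP.par s t).Conf),
        (bSet s ×ˢ rSet t : Finset (V2Closure.SP.par s t).Conf)]
      ![rSet r, rSet r, rSet r] ![bSet r, rSet r, rSet r]
      ![1/3, 1/3, 1/3] ?_ ?_ ?_ ?_ _ _ ?_ ?_
  · intro k; fin_cases k <;> norm_num
  · intro k; fin_cases k
    · exact blockDom_refl _ _
    · exact blockDom_prod_par s t (blockDom_refl _ _) (dom_r_b t)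
    · exact blockDom_prod_par s t (dom_r_b s) (blockDom_refl _ _)
  · intro k; fin_cases k
    · exact dom_r_b r
    · exact blockDom_refl _ _
    · exact blockDom_refl _ _
  · intro k _ _
    rcases k with ⟨k, hk⟩
    interval_cases k
    · exact Finset.nonempty_product.2 ⟨Finset.nonempty_product.2 ⟨hRne, hR'ne⟩, hB''ne⟩
    · exact Finset.nonempty_product.2 ⟨Finset.nonempty_product.2 ⟨hRne, hB'ne⟩, hR''ne⟩
    · exact Finset.nonempty_product.2 ⟨Finset.nonempty_product.2 ⟨hBne, hR'ne⟩, hR''ne⟩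
  · rintro ⟨q, z⟩
    simp only [Fin.sum_univ_succ, Fin.sum_univ_zero, Matrix.cons_val_zero, Matrix.cons_val_succ,
      unifDens_par_prod, unifDens_par_tail, mem_pair_prod, card_pair_prod, rLab_par, bLab_par, mem_rSet, hE]
    rcases flowOne_cases s hs q.1 with hx | hx | hx <;> rcases flowOne_cases t ht q.2 with hy | hy | hy <;>
      rcases flowOne_cases r hr z with hz | hz | hz <;>
      (simp only [hx.1, hx.2, hy.1, hy.2, hz.1, hz.2]
       first | (norm_num; done) | (norm_num; field_simp; done) | (norm_num; field_simp; norm_num))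
  · rintro ⟨q, z⟩
    simp only [Fin.sum_univ_succ, Fin.sum_univ_zero, Matrix.cons_val_zero, Matrix.cons_val_succ,
      unifDens_par_prod, unifDens_par_tail, mem_pair_prod, card_pair_prod, rLab_par, bLab_par, mem_rSet, mem_bSet,
      hE', hB, hB', hB'']
    rcases flowOne_cases s hs q.1 with hx | hx | hx <;> rcases flowOne_cases t ht q.2 with hy | hy | hy <;>
      rcases flowOne_cases r hr z with hz | hz | hz <;>
      (simp only [hx.1, hx.2, hy.1, hy.2, hz.1, hz.2]
       first | (norm_num; done) | (norm_num; field_simp))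

/-- **the certificate at `(2,1)`**: `RRB ⊔ RBR ⊔ BRR ≼ RBB ⊔ BRB ⊔ BBR` — a perfect matching, each word flips
one red -/
theorem cert3_21 (hs : FlowOne s) (ht : FlowOne t) (hr : FlowOne r) (ha : 0 < (rSet s).card)
    (ha' : 0 < (rSet t).card) (ha'' : 0 < (rSet r).card) :
    BlockDom (V2Closure.SP.par (V2Closure.SP.par s t) r)
      (tailSet (V2Closure.SP.par (V2Closure.SP.par s t) r) 2 1)
      (tailSet (V2Closure.SP.par (V2Closure.SP.par s t) r) 1 2) := by
  obtain ⟨hB, -, -, -, hRne, hBne, -, -⟩ := counts s hs ha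
  obtain ⟨hB', -, -, -, hR'ne, hB'ne, -, -⟩ := counts t ht ha'
  obtain ⟨hB'', -, -, -, hR''ne, hB''ne, -, -⟩ := counts r hr ha''
  have ha0 : ((rSet s).card : ℚ) ≠ 0 := by exact_mod_cast ne_of_gt ha
  have ha'0 : ((rSet t).card : ℚ) ≠ 0 := by exact_mod_cast ne_of_gt ha'
  have ha''0 : ((rSet r).card : ℚ) ≠ 0 := by exact_mod_cast ne_of_gt ha''
  have hE := tailCount_par3_21 s t r hs ht hr
  have hE' := tailCount_par3_12 s t r hs ht hr
  refine blockDom_par_of_certificate (V2Closure.SP.par s t) r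
      ![(rSet s ×ˢ rSet t : Finset (V2Closure.SP.par s t).Conf), (rSet s ×ˢ bSet t : Finset (V2Closure.SP.par s t).Conf), (bSet s ×ˢ rSet t : Finset (V2Closure.SP.par s t).Conf)]
      ![(rSet s ×ˢ bSet t : Finset (V2Closure.SP.par s t).Conf), (bSet s ×ˢ bSet t : Finset (V2Closure.SP.par s t).Conf), (bSet s ×ˢ rSet t : Finset (V2Closure.SP.par s t).Conf)]
      ![bSet r, rSet r, rSet r] ![bSet r, rSet r, bSet r]
      ![1/3, 1/3, 1/3] ?_ ?_ ?_ ?_ _ _ ?_ ?_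
  · intro k; fin_cases k <;> norm_num
  · intro k; fin_cases k
    · exact blockDom_prod_par s t (blockDom_refl _ _) (dom_r_b t)
    · exact blockDom_prod_par s t (dom_r_b s) (blockDom_refl _ _)
    · exact blockDom_refl _ _
  · intro k; fin_cases k
    · exact blockDom_refl _ _
    · exact blockDom_refl _ _
    · exact dom_r_b r
  · intro k _ _
    rcases k with ⟨k, hk⟩
    interval_cases k
    · exact Finset.nonempty_product.2 ⟨Finset.nonempty_product.2 ⟨hRne, hB'ne⟩, hB''ne⟩
    · exact Finset.nonempty_product.2 ⟨Finset.nonempty_product.2 ⟨hBne, hB'ne⟩, hR''ne⟩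
    · exact Finset.nonempty_product.2 ⟨Finset.nonempty_product.2 ⟨hBne, hR'ne⟩, hB''ne⟩
  · rintro ⟨q, z⟩
    simp only [Fin.sum_univ_succ, Fin.sum_univ_zero, Matrix.cons_val_zero, Matrix.cons_val_succ,
      unifDens_par_prod, unifDens_par_tail, mem_pair_prod, card_pair_prod, rLab_par, bLab_par, mem_rSet, mem_bSet,
      hE, hB, hB', hB'']
    rcases flowOne_cases s hs q.1 with hx | hx | hx <;> rcases flowOne_cases t ht q.2 with hy | hy | hy <;>
      rcases flowOne_cases r hr z with hz | hz | hz <;>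
      (simp only [hx.1, hx.2, hy.1, hy.2, hz.1, hz.2]
       first | (norm_num; done) | (norm_num; field_simp))
  · rintro ⟨q, z⟩
    simp only [Fin.sum_univ_succ, Fin.sum_univ_zero, Matrix.cons_val_zero, Matrix.cons_val_succ,
      unifDens_par_prod, unifDens_par_tail, mem_pair_prod, card_pair_prod, rLab_par, bLab_par, mem_rSet, mem_bSet,
      hE', hB, hB', hB'']
    rcases flowOne_cases s hs q.1 with hx | hx | hx <;> rcases flowOne_cases t ht q.2 with hy | hy | hy <;>
      rcases flowOne_cases r hr z with hz | hz | hz <;>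
      (simp only [hx.1, hx.2, hy.1, hy.2, hz.1, hz.2]
       first | (norm_num; done) | (norm_num; field_simp))

/-- **the certificate at `(1,2)`**: `RBB ⊔ BRB ⊔ BBR ≼ BBB` — flip the red -/
theorem cert3_12 (hs : FlowOne s) (ht : FlowOne t) (hr : FlowOne r) (ha : 0 < (rSet s).card)
    (ha' : 0 < (rSet t).card) (ha'' : 0 < (rSet r).card) :
    BlockDom (V2Closure.SP.par (V2Closure.SP.par s t) r)
      (tailSet (V2Closure.SP.par (V2Closure.SP.par s t) r) 1 2)
      (tailSet (V2Closure.SP.par (V2Closure.SP.par s t) r) 0 3) := by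
  obtain ⟨hB, -, -, -, -, hBne, -, -⟩ := counts s hs ha
  obtain ⟨hB', -, -, -, -, hB'ne, -, -⟩ := counts t ht ha'
  obtain ⟨hB'', -, -, -, -, hB''ne, -, -⟩ := counts r hr ha''
  have ha0 : ((rSet s).card : ℚ) ≠ 0 := by exact_mod_cast ne_of_gt ha
  have ha'0 : ((rSet t).card : ℚ) ≠ 0 := by exact_mod_cast ne_of_gt ha'
  have ha''0 : ((rSet r).card : ℚ) ≠ 0 := by exact_mod_cast ne_of_gt ha''
  have hE := tailCount_par3_12 s t r hs ht hr
  have hE' := tailCount_par3_03 s t r hs ht hr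
  refine blockDom_par_of_certificate (V2Closure.SP.par s t) r
      ![(rSet s ×ˢ bSet t : Finset (V2Closure.SP.par s t).Conf), (bSet s ×ˢ rSet t : Finset (V2Closure.SP.par s t).Conf), (bSet s ×ˢ bSet t : Finset (V2Closure.SP.par s t).Conf)]
      ![(bSet s ×ˢ bSet t : Finset (V2Closure.SP.par s t).Conf), (bSet s ×ˢ bSet t : Finset (V2Closure.SP.par s t).Conf), (bSet s ×ˢ bSet t : Finset (V2Closure.SP.par s t).Conf)]
      ![bSet r, bSet r, rSet r] ![bSet r, bSet r, bSet r]
      ![1/3, 1/3, 1/3] ?_ ?_ ?_ ?_ _ _ ?_ ?_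
  · intro k; fin_cases k <;> norm_num
  · intro k; fin_cases k
    · exact blockDom_prod_par s t (dom_r_b s) (blockDom_refl _ _)
    · exact blockDom_prod_par s t (blockDom_refl _ _) (dom_r_b t)
    · exact blockDom_refl _ _
  · intro k; fin_cases k
    · exact blockDom_refl _ _
    · exact blockDom_refl _ _
    · exact dom_r_b r
  · intro k _ _
    rcases k with ⟨k, hk⟩
    interval_cases k <;> exact Finset.nonempty_product.2 ⟨Finset.nonempty_product.2 ⟨hBne, hB'ne⟩, hB''ne⟩
  · rintro ⟨q, z⟩
    simp only [Fin.sum_univ_succ, Fin.sum_univ_zero, Matrix.cons_val_zero, Matrix.cons_val_succ,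
      unifDens_par_prod, unifDens_par_tail, mem_pair_prod, card_pair_prod, rLab_par, bLab_par, mem_rSet, mem_bSet,
      hE, hB, hB', hB'']
    rcases flowOne_cases s hs q.1 with hx | hx | hx <;> rcases flowOne_cases t ht q.2 with hy | hy | hy <;>
      rcases flowOne_cases r hr z with hz | hz | hz <;>
      (simp only [hx.1, hx.2, hy.1, hy.2, hz.1, hz.2]
       first | (norm_num; done) | (norm_num; field_simp))
  · rintro ⟨q, z⟩
    simp only [Fin.sum_univ_succ, Fin.sum_univ_zero, Matrix.cons_val_zero, Matrix.cons_val_succ,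
      unifDens_par_prod, unifDens_par_tail, mem_pair_prod, card_pair_prod, rLab_par, bLab_par, mem_bSet,
      hE', hB, hB', hB'']
    rcases flowOne_cases s hs q.1 with hx | hx | hx <;> rcases flowOne_cases t ht q.2 with hy | hy | hy <;>
      rcases flowOne_cases r hr z with hz | hz | hz <;>
      (simp only [hx.1, hx.2, hy.1, hy.2, hz.1, hz.2]
       first | (norm_num; done) | (norm_num; field_simp; try norm_num))

/-- **the certificate at `(0,2)`**: `E(0,2) ≼ BBB` — the tiles `BBB, BB row, B row B, row B B` of `E(0,2)` by the
first two blues, each promoted to `BBB` (`row ≼ B`) -/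
theorem cert3_02 (hs : FlowOne s) (ht : FlowOne t) (hr : FlowOne r) (ha : 0 < (rSet s).card)
    (ha' : 0 < (rSet t).card) (ha'' : 0 < (rSet r).card) :
    BlockDom (V2Closure.SP.par (V2Closure.SP.par s t) r)
      (tailSet (V2Closure.SP.par (V2Closure.SP.par s t) r) 0 2)
      (tailSet (V2Closure.SP.par (V2Closure.SP.par s t) r) 0 3) := by
  obtain ⟨hB, -, hRow, -, -, hBne, -, hRowne⟩ := counts s hs ha
  obtain ⟨hB', -, hRow', -, -, hB'ne, -, hRow'ne⟩ := counts t ht ha'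
  obtain ⟨hB'', -, hRow'', -, -, hB''ne, -, hRow''ne⟩ := counts r hr ha''
  have ha0 : ((rSet s).card : ℚ) ≠ 0 := by exact_mod_cast ne_of_gt ha
  have ha'0 : ((rSet t).card : ℚ) ≠ 0 := by exact_mod_cast ne_of_gt ha'
  have ha''0 : ((rSet r).card : ℚ) ≠ 0 := by exact_mod_cast ne_of_gt ha''
  have hrows := card_rowSet0' s hs; have hrowt := card_rowSet0' t ht; have hrowr := card_rowSet0' r hr
  have hE := tailCount_par3_02 s t r hs ht hr
  have hE' := tailCount_par3_03 s t r hs ht hr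
  have hEq : (0 : ℚ) < tailCount (V2Closure.SP.par (V2Closure.SP.par s t) r) 0 2 := by
    rw [hE]; push_cast; positivity
  have hE0 : (tailCount (V2Closure.SP.par (V2Closure.SP.par s t) r) 0 2 : ℚ) ≠ 0 := ne_of_gt hEq
  have hrow0 : ((rowSet s 0).card : ℚ) ≠ 0 := by exact_mod_cast ne_of_gt (Finset.card_pos.2 hRowne)
  have hrow'0 : ((rowSet t 0).card : ℚ) ≠ 0 := by exact_mod_cast ne_of_gt (Finset.card_pos.2 hRow'ne)
  have hrow''0 : ((rowSet r 0).card : ℚ) ≠ 0 := by exact_mod_cast ne_of_gt (Finset.card_pos.2 hRow''ne)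
  refine blockDom_par_of_certificate (V2Closure.SP.par s t) r
      ![(bSet s ×ˢ bSet t : Finset (V2Closure.SP.par s t).Conf), (bSet s ×ˢ bSet t : Finset (V2Closure.SP.par s t).Conf), (bSet s ×ˢ rowSet t 0 : Finset (V2Closure.SP.par s t).Conf), (rowSet s 0 ×ˢ bSet t : Finset (V2Closure.SP.par s t).Conf)]
      ![(bSet s ×ˢ bSet t : Finset (V2Closure.SP.par s t).Conf), (bSet s ×ˢ bSet t : Finset (V2Closure.SP.par s t).Conf), (bSet s ×ˢ bSet t : Finset (V2Closure.SP.par s t).Conf), (bSet s ×ˢ bSet t : Finset (V2Closure.SP.par s t).Conf)]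
      ![bSet r, rowSet r 0, bSet r, bSet r] ![bSet r, bSet r, bSet r, bSet r]
      ![((rSet s).card * (rSet t).card * (rSet r).card : ℕ)
          / (tailCount (V2Closure.SP.par (V2Closure.SP.par s t) r) 0 2 : ℕ),
        ((rSet s).card * (rSet t).card * (rowSet r 0).card : ℕ)
          / (tailCount (V2Closure.SP.par (V2Closure.SP.par s t) r) 0 2 : ℕ),
        ((rSet s).card * (rowSet t 0).card * (rSet r).card : ℕ)
          / (tailCount (V2Closure.SP.par (V2Closure.SP.par s t) r) 0 2 : ℕ),
        ((rowSet s 0).card * (rSet t).card * (rSet r).card : ℕ)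
          / (tailCount (V2Closure.SP.par (V2Closure.SP.par s t) r) 0 2 : ℕ)]
      ?_ ?_ ?_ ?_ _ _ ?_ ?_
  · intro k; fin_cases k
    · show (0 : ℚ) ≤ ((rSet s).card * (rSet t).card * (rSet r).card : ℕ)
        / (tailCount (V2Closure.SP.par (V2Closure.SP.par s t) r) 0 2 : ℕ)
      positivity
    · show (0 : ℚ) ≤ ((rSet s).card * (rSet t).card * (rowSet r 0).card : ℕ)
        / (tailCount (V2Closure.SP.par (V2Closure.SP.par s t) r) 0 2 : ℕ)
      positivity
    · show (0 : ℚ) ≤ ((rSet s).card * (rowSet t 0).card * (rSet r).card : ℕ)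
        / (tailCount (V2Closure.SP.par (V2Closure.SP.par s t) r) 0 2 : ℕ)
      positivity
    · show (0 : ℚ) ≤ ((rowSet s 0).card * (rSet t).card * (rSet r).card : ℕ)
        / (tailCount (V2Closure.SP.par (V2Closure.SP.par s t) r) 0 2 : ℕ)
      positivity
  · intro k; fin_cases k
    · exact blockDom_refl _ _
    · exact blockDom_refl _ _
    · exact blockDom_prod_par s t (blockDom_refl _ _) (dom_row_b t)
    · exact blockDom_prod_par s t (dom_row_b s) (blockDom_refl _ _)
  · intro k; fin_cases k
    · exact blockDom_refl _ _
    · exact dom_row_b r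
    · exact blockDom_refl _ _
    · exact blockDom_refl _ _
  · intro k _ _
    rcases k with ⟨k, hk⟩
    interval_cases k <;> exact Finset.nonempty_product.2 ⟨Finset.nonempty_product.2 ⟨hBne, hB'ne⟩, hB''ne⟩
  · rintro ⟨q, z⟩
    simp only [Fin.sum_univ_succ, Fin.sum_univ_zero, Matrix.cons_val_zero, Matrix.cons_val_succ,
      unifDens_par_prod, unifDens_par_tail, mem_pair_prod, card_pair_prod, rLab_par, bLab_par, mem_bSet,
      mem_rowSet0, hB, hB', hB'']
    rcases flowOne_cases s hs q.1 with hx | hx | hx <;> rcases flowOne_cases t ht q.2 with hy | hy | hy <;>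
      rcases flowOne_cases r hr z with hz | hz | hz <;>
      (simp (config := { decide := true }) only [hx.1, hx.2, hy.1, hy.2, hz.1, hz.2, if_true, if_false, mul_zero,
         add_zero, zero_add]
       first | done | (field_simp))
  · rintro ⟨q, z⟩
    simp only [Fin.sum_univ_succ, Fin.sum_univ_zero, Matrix.cons_val_zero, Matrix.cons_val_succ,
      unifDens_par_prod, unifDens_par_tail, mem_pair_prod, card_pair_prod, rLab_par, bLab_par, mem_bSet,
      hE', hB, hB', hB'']
    rcases flowOne_cases s hs q.1 with hx | hx | hx <;> rcases flowOne_cases t ht q.2 with hy | hy | hy <;>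
      rcases flowOne_cases r hr z with hz | hz | hz <;>
      (simp (config := { decide := true }) only [hx.1, hx.2, hy.1, hy.2, hz.1, hz.2, if_true, if_false, mul_zero,
         add_zero, zero_add]
       first | done | (field_simp; rw [hE, hrows, hrowt, hrowr]; push_cast; ring))

/-- **the certificate at `(3,−1)`**: `RRR ≼ E(2,0)` — the tiles `RR·, R col R, col R R` of `E(2,0)` by the first two
reds, each reached by relaxing a red (`R ≼ all`, `R ≼ col`) -/
theorem cert3_3m (hs : FlowOne s) (ht : FlowOne t) (hr : FlowOne r) (ha : 0 < (rSet s).card)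
    (ha' : 0 < (rSet t).card) (ha'' : 0 < (rSet r).card) :
    BlockDom (V2Closure.SP.par (V2Closure.SP.par s t) r)
      (tailSet (V2Closure.SP.par (V2Closure.SP.par s t) r) 3 0)
      (tailSet (V2Closure.SP.par (V2Closure.SP.par s t) r) 2 0) := by
  obtain ⟨-, hCol, -, -, hRne, -, hColne, -⟩ := counts s hs ha
  obtain ⟨-, hCol', -, -, hR'ne, -, hCol'ne, -⟩ := counts t ht ha'
  obtain ⟨-, -, -, -, hR''ne, -, -, -⟩ := counts r hr ha''
  have ha0 : ((rSet s).card : ℚ) ≠ 0 := by exact_mod_cast ne_of_gt ha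
  have ha'0 : ((rSet t).card : ℚ) ≠ 0 := by exact_mod_cast ne_of_gt ha'
  have ha''0 : ((rSet r).card : ℚ) ≠ 0 := by exact_mod_cast ne_of_gt ha''
  have hcr := card_conf_eq r hr
  have hcols := card_colSet' s hs; have hcolt := card_colSet' t ht
  have hE := tailCount_par3_30 s t r hs ht hr
  have hE' := tailCount_par3_20 s t r hs ht hr
  have hE'q : (0 : ℚ) < tailCount (V2Closure.SP.par (V2Closure.SP.par s t) r) 2 0 := by
    rw [hE']; push_cast; positivity
  have hE'0 : (tailCount (V2Closure.SP.par (V2Closure.SP.par s t) r) 2 0 : ℚ) ≠ 0 := ne_of_gt hE'q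
  have hcol0 : ((colSet s).card : ℚ) ≠ 0 := by exact_mod_cast ne_of_gt (Finset.card_pos.2 hColne)
  have hcol'0 : ((colSet t).card : ℚ) ≠ 0 := by exact_mod_cast ne_of_gt (Finset.card_pos.2 hCol'ne)
  have hn''0 : (Fintype.card r.Conf : ℚ) ≠ 0 := by
    exact_mod_cast ne_of_gt (lt_of_lt_of_le ha'' (card_rSet_le r))
  refine blockDom_par_of_certificate (V2Closure.SP.par s t) r
      ![(rSet s ×ˢ rSet t : Finset (V2Closure.SP.par s t).Conf), (rSet s ×ˢ rSet t : Finset (V2Closure.SP.par s t).Conf), (rSet s ×ˢ rSet t : Finset (V2Closure.SP.par s t).Conf)]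
      ![(rSet s ×ˢ rSet t : Finset (V2Closure.SP.par s t).Conf), (rSet s ×ˢ colSet t : Finset (V2Closure.SP.par s t).Conf), (colSet s ×ˢ rSet t : Finset (V2Closure.SP.par s t).Conf)]
      ![rSet r, rSet r, rSet r] ![Finset.univ, rSet r, rSet r]
      ![((rSet s).card * (rSet t).card * Fintype.card r.Conf : ℕ)
          / (tailCount (V2Closure.SP.par (V2Closure.SP.par s t) r) 2 0 : ℕ),
        ((rSet s).card * (colSet t).card * (rSet r).card : ℕ)
          / (tailCount (V2Closure.SP.par (V2Closure.SP.par s t) r) 2 0 : ℕ),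
        ((colSet s).card * (rSet t).card * (rSet r).card : ℕ)
          / (tailCount (V2Closure.SP.par (V2Closure.SP.par s t) r) 2 0 : ℕ)]
      ?_ ?_ ?_ ?_ _ _ ?_ ?_
  · intro k; fin_cases k
    · show (0 : ℚ) ≤ ((rSet s).card * (rSet t).card * Fintype.card r.Conf : ℕ)
        / (tailCount (V2Closure.SP.par (V2Closure.SP.par s t) r) 2 0 : ℕ)
      positivity
    · show (0 : ℚ) ≤ ((rSet s).card * (colSet t).card * (rSet r).card : ℕ)
        / (tailCount (V2Closure.SP.par (V2Closure.SP.par s t) r) 2 0 : ℕ)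
      positivity
    · show (0 : ℚ) ≤ ((colSet s).card * (rSet t).card * (rSet r).card : ℕ)
        / (tailCount (V2Closure.SP.par (V2Closure.SP.par s t) r) 2 0 : ℕ)
      positivity
  · intro k; fin_cases k
    · exact blockDom_refl _ _
    · exact blockDom_prod_par s t (blockDom_refl _ _) (dom_r_col t)
    · exact blockDom_prod_par s t (dom_r_col s) (blockDom_refl _ _)
  · intro k; fin_cases k
    · exact dom_r_univ r
    · exact blockDom_refl _ _
    · exact blockDom_refl _ _
  · intro k _ _
    rcases k with ⟨k, hk⟩
    interval_cases k
    · exact Finset.nonempty_product.2 ⟨Finset.nonempty_product.2 ⟨hRne, hR'ne⟩, Finset.univ_nonempty_iff.2 ⟨redConf r⟩⟩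
    · exact Finset.nonempty_product.2 ⟨Finset.nonempty_product.2 ⟨hRne, hCol'ne⟩, hR''ne⟩
    · exact Finset.nonempty_product.2 ⟨Finset.nonempty_product.2 ⟨hColne, hR'ne⟩, hR''ne⟩
  · rintro ⟨q, z⟩
    simp only [Fin.sum_univ_succ, Fin.sum_univ_zero, Matrix.cons_val_zero, Matrix.cons_val_succ,
      unifDens_par_prod, unifDens_par_tail, mem_pair_prod, card_pair_prod, rLab_par, bLab_par, mem_rSet, hE]
    rcases flowOne_cases s hs q.1 with hx | hx | hx <;> rcases flowOne_cases t ht q.2 with hy | hy | hy <;>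
      rcases flowOne_cases r hr z with hz | hz | hz <;>
      (simp only [hx.1, hx.2, hy.1, hy.2, hz.1, hz.2]
       first | (norm_num; done) | (norm_num; field_simp; rw [hE', hcr, hcols, hcolt]; push_cast; ring))
  · rintro ⟨q, z⟩
    simp only [Fin.sum_univ_succ, Fin.sum_univ_zero, Matrix.cons_val_zero, Matrix.cons_val_succ,
      unifDens_par_prod, unifDens_par_tail, mem_pair_prod, card_pair_prod, rLab_par, bLab_par, mem_rSet, mem_colSet,
      Finset.mem_univ, and_true, Finset.card_univ]
    rcases flowOne_cases s hs q.1 with hx | hx | hx <;> rcases flowOne_cases t ht q.2 with hy | hy | hy <;>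
      rcases flowOne_cases r hr z with hz | hz | hz <;>
      (simp only [hx.1, hx.2, hy.1, hy.2, hz.1, hz.2]
       first | (norm_num; done) | (norm_num; field_simp))

end Certificates

end Summit.Ventures.PercRepro2.Tail2D
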